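import Literature.MathematicalPhysics.QuantumFieldTheory.Balaban1983to89.B2Eq2112Replacement

/-!
# `Balaban1983to89.B2Eq289Decomposition` — [Balaban1982Higgs2] (2.88)–(2.91) pp. 575–576: the decomposition of the
background field `A^{(k)}` after the translation (2.80), `θ_{k+1}A^{(k)} = θ_{k+1}A′^{(k)} + B̃^{(k)} + θ_{k+1}B^{(k+1),η}`
(2.89) — PROVED EXACTLY over part I's `B1RG242.StepData` (the recursive equation (I.2.41) = `B1Eq333Decomposition.eq342_op`)
with the entrywise cut-offs `ζ^{(k)}`, `ζ^{(k+1)}` of (2.44); the smallness (2.90) `B̃^{(k)}(x) = O((Lᵏε)^κ)` PROVED from the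
printed kernel shapes; (2.91); and the last line of (2.93) p. 576

statement-level skeleton of published theorems with citation tags; proofs where landed; nothing here is a claim about the Yang–Mills mass gap

PDF held: `paper:balaban1982-cmp86-higgs23-ii` (T. Bałaban, *(Higgs)₂,₃ quantum fields in a finite volume. II. An upper
bound*, Commun. Math. Phys. **86** (1982) 555–594, doi 10.1007/bf01214890; journal page = PDF page + 554); pp. 575–576
[PDF 21–22] READ AS IMAGES on the ×2 renders
`run/shared/lean/pub/pub-balaban/b2b-balaban-ref1/pages/1982-cmp86-higgs23-II/1982-cmp86-higgs23-II-p021-x2.png`, `…-p022-x2.png`;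
pp. 561, 566–567 [PDF 7, 12–13] for `ζ`, `ζ^{(k)}`, `θ_k`, (2.44)–(2.45); part I [Balaban1982Higgs1] pp. 610–611 [PDF 8–9] for
Props. I.2.1–I.2.3, (I.2.35)–(I.2.36).

CITATION HEADER — WHAT IS REPRODUCED.  The displays (2.88)–(2.91) p. 575 have NO SKELETON row today (ROWS-B2 jumps from
B2.Eq2.86 to B2.Eq2.103; a row request is with the B2 fold owner r02, HOME/STATUS 2026-08-21T12:15:16Z); this file is the
Phase-2 proof-lane companion of the seat's `…B2Eq287Translation` ((2.80)/(2.87), p268882).  Unit `lit-balaban-p15` gen 5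
(Phase-2 proof seat p15; HOME `run/shared/lean/pub/lit-balaban/`, seat dir `lit-balaban-p15/`); B2 fold owner r02, second
reader r14; referee ref-4.  Inputs BY NAME: part I's `B1RG242.StepData` (p12: `Gk`, `Qks`, `Ck`, `Qs`, `Gk1`, `Qk1s`, `α`,
`β`, `γ`) and p14's `B1Eq333Decomposition.eq342_op` ((I.2.41)/(I.3.42): `a_kaL⁻²·G_kQ_k^*C^{(k)}Q* = a_{k+1}L⁻²·G_{k+1}Q*_{k+1}`);
r14's `B2StepK.bg244` ((2.44), the entrywise cut-off `ζ ⊙ (G_kQ_k^*)`), `B2Sect2BDensities.aTilde245`, `B2IndStep2115.bTilde582`;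
r02's `B2Eq218Translation.restrict`, `B2Eq224FirstStepFields.transl223`; the seat's engines `B2Eq2112Replacement.sum_abs_kernel_le`,
`B2Lemma25Proof.far_sum_bound` (p23), `B2Eq236Replacements.pFn_le_rpow`/`abs_Qs_restrict_le`, `B2Eq225PsiOne.decay_threshold_pow₁`,
`B2StepK.rDecayBeatsPowers` (r14), `B2LargeField.thrA` (r14).

WHAT IS PRINTED (p. 575 [PDF 21], verbatim).  *"The remaining terms of the action depend on the field Λ₀^{(k)}A only through
the field A^{(k)}. The result of the translation (2.80) on the configuration A^{(k)} will be represented in different ways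
depending on the sets on which the configuration is considered. Thus we have A^{(k)} = (1 − θ_{k+1})A^{(k)} + θ_{k+1}A^{(k)} and
(1 − θ_{k+1})θ_kA^{(k)} = a_k(1 − θ_{k+1})θ_kζ^{(k)}G_kQ_k^*(A′ + aL⁻²C^{(k)}_{Λ₀^{(k)}}Q*B),  (2.88)
θ_{k+1}A^{(k)} = a_kθ_{k+1}ζ^{(k)}G_kQ_k^*A′ + a_kaL⁻²θ_{k+1}ζ^{(k)}G_kQ_k^*δC^{(k)}_{Λ₀^{(k)}}Q*B
 − a_kaL⁻²θ_{k+1}(1 − ζ^{(k)})G_kQ_k^*C^{(k)}Q*Λ₀^{(k)′}B + a_{k+1}L⁻²θ_{k+1}(1 − ζ^{(k+1)})G^η_{k+1}Q*_{k+1}Λ₀^{(k)′}B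
 + a_{k+1}L⁻²θ_{k+1}ζ^{(k+1)}G^η_{k+1}Q*_{k+1}B =: θ_{k+1}A′^{(k)} + B̃^{(k)} + θ_{k+1}B^{(k+1),η},  (2.89)
where by the definition B̃^{(k)} is the sum of the second, third and fourth terms on the right side of (2.89). From the
restrictions introduced by the functions ζ^{(k)}, ζ^{(k+1)}, the restrictions on the field B and the Propositions
I.2.1–I.2.3, 2.2 we get  B̃^{(k)}(x) = O((Lᵏε)^κ) for every κ,  (2.90)  and similar estimates for the derivative. From (2.86)
it follows that the field θ_{k+1}A′^{(k)} is smooth and small: |θ_{k+1}A′^{(k)}(x)| ≦ O(1)p(Lᵏε),  (2.91) similarly for the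
derivative."*  And p. 576 (2.93), last line: *"… + (1 − θ_{k+1})θ_kA^{(k),L^{−j}} + θ_{k+1}B^{(k+1),L^{−j}} + (θ_{k+1}A′^{(k),L^{−j}}
+ B̃^{(k),L^{−j}})"*.  The inputs, verbatim: (2.44) p. 566 *"A^{(k),ε} = a_k(Lᵏε)⁻²ζ^{(k)}G^ε_kQ^*_kA, where the function
ζ^{(k)}(x, y) is defined for x ∈ T_η, y ∈ T₁^{(k)}, … supp ζ^{(k)}(·, y) is contained in the set {x ∈ T_η : |x − y| <
r(Lᵏε) − 2M} and ζ^{(k)}(x, y) = 1 if |x − y| ≦ ½r(Lᵏε). The function θ_k is defined on T_η, is equal to 1 on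
B^{k−1}(Λ₂^{(k−1)}) and varies "smoothly" from 1 to 0 on a slice of thickness < M surrounding B^{k−1}(Λ₂^{(k−1)})"*; p. 561
*"ζC^{(0)}Q* denotes an operator with the kernel (ζC^{(0)}Q*)(x, y) = ζ(x, y)L^{−d}Σ_{x′∈B(y)}C^{(0)}(x, x′) … ζ(x, y) = 1 if
|x − y| ≦ ½r(ε), ζ(x, y) = 0 if |x − y| > ½r(ε). A definition of the operator (1 − ζ)C^{(0)}Q* should be clear"*; part I
(2.35)–(2.36) p. 611 *"δC^{(k)}_Λ(Ω, A) = C^{(k)}_Λ(Ω, A) − C^{(k)}(Ω, A), (2.35) … |δC^{(k)}_Λ(Ω, A; x, x′)| ≦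
c₀exp(−δ₀(|x − x′| + dist(x, Λᶜ) + dist(x′, Λᶜ))), x, x′ ∈ Λ (2.36)"*, (2.34) *"|C^{(k)}_Λ(Ω, A; x, x′)| ≦ c₀exp(−δ₀|x − x′|)"*;
Prop. 2.2 (2.58) p. 571 (*"The identical inequality holds for G_k(Ω, A)Q_k^*(A)"*: `|(G_kQ_k^*)(x, y)| ≤ c₀e^{−δ₀dist(x,y)}`);
(2.17) p. 560 *"|B(y)| ≦ (2/(μ₀ε))p(ε) for y ∈ Λ′₋₁"* (at the scale Lᵏε); (2.8) p. 558 (the r(Lᵏε)-collars between the Λ_i^{(k)}).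

THE ARGUMENT (the print gives the five terms; the algebra behind them, made explicit).  Write `𝒢 = G_kQ_k^*`, `𝒢₁ =
G^η_{k+1}Q*_{k+1}`, `c = aL⁻²`, `Λ₀ = Λ₀^{(k)}`.  `θ_{k+1}A^{(k)} = a_kθ_{k+1}(ζ^{(k)}𝒢)(A′ + cC_{Λ₀}Q*B)`; on the rows `y`
that `θ_{k+1}ζ^{(k)}(x, ·)` sees (`y ∈ Λ₀`, indeed deep inside: `hθζ`), `C_{Λ₀}Q*B = δC_{Λ₀}Q*B + C^{(k)}Q*Λ₀′B` ((I.2.35) on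
`Λ₀ × Λ₀`, the Dirichlet support of `C_{Λ₀}`, and `Λ₀(Q*B) = Q*Λ₀′B` — unions of big blocks); `ζ^{(k)}𝒢 = 𝒢 − (1 − ζ^{(k)})𝒢`;
`a_kc·𝒢C^{(k)}Q* = a_{k+1}L⁻²𝒢₁` ((I.2.41)); `𝒢₁ = (1 − ζ^{(k+1)})𝒢₁ + ζ^{(k+1)}𝒢₁`; and finally `θ_{k+1}(ζ^{(k+1)}𝒢₁)Λ₀′B =
θ_{k+1}(ζ^{(k+1)}𝒢₁)B` because the FINITE RANGE of `ζ^{(k+1)}` keeps `supp θ_{k+1}ζ^{(k+1)}(x, ·)` inside `Λ₀′` (`hθζ'`).  This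
last step is where (2.89) — whose fifth term carries the FULL `B`, as it must: `θ_{k+1}B^{(k+1),η}` is the next step's
external field (2.45)/(2.93) — uses the cut-off: without `hθζ'` the five printed terms differ from `θ_{k+1}A^{(k)}` by exactly
`a_{k+1}L⁻²θ_{k+1}(ζ^{(k+1)}𝒢₁)Λ₀′ᶜB` (`eq289_defect`).  READING NOTE (located, no claim of error): `hθζ'` holds under Sect. A's
range convention p. 561 (`ζ(x, y) = 0 if |x − y| > ½r`) since `dist(Bᵏ(Λ₂^{(k)}), Λ₀^{(k)c}) ≥ 2r(Lᵏε)` by (2.8) twice; under the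
p. 566 support bound `r(L^{k+1}ε) − 2M` read in the units of `T₁^{(k+1)}` it is an additional requirement when `L > 2`.  Both
support facts enter this file as the explicit hypotheses `hθζ`, `hθζ'` IN PRINTED FORM (what the cut-offs see), not derived
from a metric.
(2.90): the three terms of `B̃^{(k)}(x)` are kernel sums — ROW-DAMPED (`δC_{Λ₀}` on rows `≥ R₂` inside `Λ₀`, (I.2.36)), FAR in
`𝒢` (`1 − ζ^{(k)} ≠ 0 ⇒ dist ≥ R₃ = ½r(Lᵏε)`), FAR in `𝒢₁` (`1 − ζ^{(k+1)} ≠ 0 ⇒ dist ≥ R₄`) — against the (2.17) threshold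
`G = 2p(ℓ)/(μ₀ℓ)` for `B` on `Λ₀′`: `|B̃^{(k)}(x)| ≤ (|a_kc|·c₀c₁qs₁S₁S₂·(e^{−δ₀R₂} + e^{−½δ₀R₃}) + |a_{k+1}L⁻²|·c₁′S₃·e^{−½δ₀R₄})·G`,
and `e^{−¼δ₀r(L^{k+1}ε)}·G ≤ C_κ(Lᵏε)^κ` for every κ (`B2StepK.rDecayBeatsPowers` one scale up: all three separations are
`≥ ½r(L^{k+1}ε)` in either convention, `r(·)` being antitone).
(2.91): `θ_{k+1}A′^{(k)}(x) = a_kθ_{k+1}(x)Σ_yζ^{(k)}(x,y)𝒢(x,y)A′(y)` only sees `y ∈ Λ₁^{(k)}` (`hθζ₁`), where (2.86) gives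
`|A′(y)| ≤ O(1)p(Lᵏε)`: `|θ_{k+1}A′^{(k)}(x)| ≤ |a_k|c₁S₁·O(1)p(Lᵏε)`.

DICTIONARY (plain real coordinates, as in the seat's (2.36)–(2.40), (2.112) files).  `ι` ↤ components of the η-lattice
fields, `κ` ↤ of the unit-lattice (`T₁^{(k)}`) fields, `ν` ↤ of the block (`L`-lattice, `T^{(k+1)} = T₁^{(k)′}`) fields;
`S : B1RG242.StepData ℝ ι κ ν` ↤ the step's operators (`S.Gk * S.Qks` ↤ `𝒢 = G_kQ_k^*`, `S.Ck` ↤ `C^{(k)}`, `S.Qs` ↤ `Q*`,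
`S.Gk1 * S.Qk1s` ↤ `𝒢₁ = G^η_{k+1}Q*_{k+1}`, `S.α` ↤ `a_k`, `S.β` ↤ `aL⁻²`, `S.γ` ↤ `a_{k+1}L⁻²` by (I.2.13) `B1RG242.StepData.γ_printed`);
`ζ : Matrix ι κ ℝ` ↤ `ζ^{(k)}(x, y)`, `ζ' : Matrix ι ν ℝ` ↤ `ζ^{(k+1)}(x, z)` (entrywise cut-offs, `⊙`), `θ θ' : ι → ℝ` ↤ `θ_k`,
`θ_{k+1}`; `CΛ : Matrix κ κ ℝ` ↤ `C^{(k)}_{Λ₀^{(k)}}` extended by zero (`hCs`: support in `Λ₀ × Λ₀`); `Λ₀ : Finset κ` ↤ `Λ₀^{(k)}`,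
`Λ₀' : Finset ν` ↤ `Λ₀^{(k)′}`, `Λ₁ : Finset κ` ↤ `Λ₁^{(k)}`; `hQ0` ↤ the block structure of `Q*` (`Q*(y, z) ≠ 0 ⇒ (y ∈ Λ₀ ⇔
z ∈ Λ₀′)`); `A' : κ → ℝ`, `B : ν → ℝ` ↤ one real component of `A′`, `B`; `d₁ x y`, `d₁' x z`, `d₂ y y′` ↤ the distances in
(2.58)/(I.2.34), `u y` ↤ `dist(y, Λ₀ᶜ)` of (I.2.36); `G` ↤ the (2.17) threshold for `|B|` on `Λ₀′`; `S₁, S₂, S₃` ↤ bounds for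
the exponential row sums (on `ℤ^d`: `B2Lemma25Proof.sum_exp_neg_l1dist_le`); `R₂, R₃, R₄` ↤ the separations the cut-offs give.

WHAT IS KERNEL-CHECKED (zero `sorry`, standard axioms).
 §0 scalars: `two_thrA_pFn_eq`, `decay_thr217_pow` ((2.17) threshold vs. decay, every κ), `decay_nextscale_thr217_pow` (the
    same with the decay governed by `r(L·ℓ)`, `L ≥ 1`, `Lℓ ≤ 1`);
 §1 the objects: `Ak` (`A^{(k)} = a_kζ^{(k)}G_kQ_k^*A`; `Ak_eq_bg244`), `Bnext` (`B^{(k+1),η}`), `oneSub` (`1 − ζ`), `deltaC`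
    ((I.2.35) on `Λ × Λ`), **`bTilde`** (`B̃^{(k)}` := terms 2 + 3 + 4 of (2.89)); kernel lemmas `hadamard_mulVec_apply`,
    `hadamard_add_oneSub`, `hadamard_mulVec_congr`, `CΛ_mulVec_split` (`C_{Λ₀}Q*B = δC_{Λ₀}Q*B + C^{(k)}Q*Λ₀′B` on `Λ₀`);
 §2 **(2.88)** `eq288`; **(2.89)** `eq289` (EXACT under `hθζ`, `hθζ'`), `eq289_defect` (the exact discrepancy without `hθζ'`),
    **(2.93) last line** `eq293_last` (`θ_kA^{(k)} = (1 − θ_{k+1})θ_kA^{(k)} + θ_{k+1}B^{(k+1),η} + (θ_{k+1}A′^{(k)} + B̃^{(k)})`,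
    = r14's `bTilde582`/`aTilde245` two-scale field plus the small field, where `θ_k = 1` on `supp θ_{k+1}`);
 §3 **(2.90)** `bTilde_bound`, `bTilde_pow` (every κ); **(2.91)** `eq291_bound`.
HONEST SCOPE.  The operators are part I's algebraic `StepData` (whole-lattice inverses under `IsUnit` hypotheses, as in
r14's `B2IndStep2115` and the seat's `B2Eq2112Replacement`); the analytic inputs (Props. I.2.1–I.2.3, 2.2: decay shapes,
and the cut-off geometry) enter as hypotheses IN THE PRINTED FORM; *"similar estimates for the derivative"* are not
reproduced (they are the same sums with `∂^η_x` on the first kernel, (2.58) for `D^η_AG_kQ_k^*`).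
-/

namespace Literature.MathematicalPhysics.QuantumFieldTheory.Balaban1983to89.B2Eq289Decomposition

open Real Matrix
open scoped Matrix
open B2Eq218Translation (restrict)
open B2Eq236Replacements (pFn_le_rpow pFn_nonneg abs_Qs_restrict_le)
open B2Lemma25Proof (far_sum_bound)
open B2Eq2112Replacement (sum_abs_kernel_le sum_exp_le_of_rate Qs_mulVec_eq_restrict)
open B2Eq225PsiOne (decay_threshold_pow₁)

/-! ## §0 Scalars: the (2.17) threshold on `B` against the decay, *"for every κ"* -/

/-- The (2.17) threshold in the power form: `2·p(ℓ)/(μ₀ℓ) = (2/μ₀)·p(ℓ)·ℓ^{−1}` (`B2LargeField.thrA μ₀ ℓ p = p/(μ₀ℓ)`), `ℓ > 0`.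
[cite: Balaban1982Higgs2, (2.17) p.560] -/
theorem two_thrA_pFn_eq {μ₀ ℓ b₀ p : ℝ} (hℓ : 0 < ℓ) :
    2 * B2LargeField.thrA μ₀ ℓ (B2.pFn b₀ p ℓ) = (2 / μ₀) * B2.pFn b₀ p ℓ * ℓ ^ (-(1 : ℝ)) := by
  unfold B2LargeField.thrA
  rw [Real.rpow_neg_one]
  by_cases hμ : μ₀ = 0
  · simp [hμ]
  · field_simp

/-- **"O((Lᵏε)^κ)" under the PRINTED threshold (2.17)**: for `a > 0`, the ranges of (2.7), `b₀ ≥ 0`, `p ≥ 0`, `μ₀ > 0` and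
every real `κ` there is `C ≥ 0` with `e^{−a·r(ℓ)}·(2p(ℓ)/(μ₀ℓ)) ≤ C·ℓ^κ` for all `ℓ ∈ (0,1]`. [cite: Balaban1982Higgs2, (2.90) p.575] -/
theorem decay_thr217_pow {a Rr r b₀ p μ₀ : ℝ} (ha : 0 < a) (hR : 0 < Rr) (hr : 1 < r) (hb : 0 ≤ b₀) (hp : 0 ≤ p)
    (hμ : 0 < μ₀) (κ : ℝ) :
    ∃ C : ℝ, 0 ≤ C ∧ ∀ ℓ : ℝ, 0 < ℓ → ℓ ≤ 1 →
      Real.exp (-(a * B2.rFn Rr r ℓ)) * (2 * B2LargeField.thrA μ₀ ℓ (B2.pFn b₀ p ℓ)) ≤ C * ℓ ^ κ := by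
  obtain ⟨C, hC0, hC⟩ := decay_threshold_pow₁ (m := (1 : ℝ)) ha hR hr hb hp
    (show (0 : ℝ) ≤ 2 / μ₀ by positivity) κ
  refine ⟨C, hC0, fun ℓ hℓ hℓ1 => ?_⟩
  rw [two_thrA_pFn_eq hℓ]
  exact hC ℓ hℓ hℓ1

/-- **The same one scale up**: when the decay is governed by `r(L·ℓ)` (the range of `ζ^{(k+1)}`, `ℓ = Lᵏε`), for `L ≥ 1`:
for every κ there is `C ≥ 0` with `e^{−a·r(Lℓ)}·(2p(ℓ)/(μ₀ℓ)) ≤ C·ℓ^κ` whenever `0 < ℓ`, `Lℓ ≤ 1` — `B2StepK.rDecayBeatsPowers`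
at the scale `Lℓ` with the exponent `κ + p + 1`, and `(Lℓ)^{κ+p+1} = L^{κ+p+1}ℓ^{κ+p+1}`. [cite: Balaban1982Higgs2, (2.90) p.575] -/
theorem decay_nextscale_thr217_pow {a Rr r b₀ p μ₀ L : ℝ} (ha : 0 < a) (hR : 0 < Rr) (hr : 1 < r) (hb : 0 ≤ b₀)
    (hp : 0 ≤ p) (hμ : 0 < μ₀) (hL : 1 ≤ L) (κ : ℝ) :
    ∃ C : ℝ, 0 ≤ C ∧ ∀ ℓ : ℝ, 0 < ℓ → L * ℓ ≤ 1 →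
      Real.exp (-(a * B2.rFn Rr r (L * ℓ))) * (2 * B2LargeField.thrA μ₀ ℓ (B2.pFn b₀ p ℓ)) ≤ C * ℓ ^ κ := by
  obtain ⟨C₀, hC₀⟩ := B2StepK.rDecayBeatsPowers ha hR hr (κ + p + 1)
  have hL0 : 0 < L := lt_of_lt_of_le one_pos hL
  refine ⟨max C₀ 0 * L ^ (κ + p + 1) * (2 / μ₀ * b₀), by positivity, fun ℓ hℓ hLℓ => ?_⟩
  have hℓ1 : ℓ ≤ 1 := by nlinarith
  have hLℓ0 : 0 < L * ℓ := mul_pos hL0 hℓ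
  have hexp : Real.exp (-(a * B2.rFn Rr r (L * ℓ))) ≤ max C₀ 0 * (L ^ (κ + p + 1) * ℓ ^ (κ + p + 1)) := by
    rw [← Real.mul_rpow hL0.le hℓ.le]
    exact (hC₀ (L * ℓ) hLℓ0 hLℓ).trans
      (mul_le_mul_of_nonneg_right (le_max_left _ _) (Real.rpow_nonneg hLℓ0.le _))
  rw [two_thrA_pFn_eq hℓ]
  have hT : 2 / μ₀ * B2.pFn b₀ p ℓ * ℓ ^ (-(1 : ℝ)) ≤ 2 / μ₀ * (b₀ * ℓ ^ (-p)) * ℓ ^ (-(1 : ℝ)) :=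
    mul_le_mul_of_nonneg_right (mul_le_mul_of_nonneg_left (pFn_le_rpow hb hp hℓ hℓ1) (by positivity))
      (Real.rpow_nonneg hℓ.le _)
  have hT0 : 0 ≤ 2 / μ₀ * B2.pFn b₀ p ℓ * ℓ ^ (-(1 : ℝ)) := by
    have := pFn_nonneg (p := p) hb hℓ hℓ1
    positivity
  calc Real.exp (-(a * B2.rFn Rr r (L * ℓ))) * (2 / μ₀ * B2.pFn b₀ p ℓ * ℓ ^ (-(1 : ℝ)))
      ≤ (max C₀ 0 * (L ^ (κ + p + 1) * ℓ ^ (κ + p + 1))) * (2 / μ₀ * (b₀ * ℓ ^ (-p)) * ℓ ^ (-(1 : ℝ))) :=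
        mul_le_mul hexp hT hT0 (by positivity)
    _ = max C₀ 0 * L ^ (κ + p + 1) * (2 / μ₀ * b₀) * (ℓ ^ (κ + p + 1) * ℓ ^ (-p) * ℓ ^ (-(1 : ℝ))) := by ring
    _ = max C₀ 0 * L ^ (κ + p + 1) * (2 / μ₀ * b₀) * ℓ ^ κ := by
        rw [← Real.rpow_add hℓ, ← Real.rpow_add hℓ]
        congr 1
        ring_nf

/-! ## §1 The objects of (2.88)–(2.89) -/

section Objects

variable {ι κ ν : Type*} [Fintype ι] [Fintype κ] [Fintype ν] [DecidableEq ι] [DecidableEq κ] [DecidableEq ν]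

/-- `1 − ζ` as a kernel: *"A definition of the operator (1 − ζ)C^{(0)}Q* should be clear"* (p. 561) — the entrywise
complement of the cut-off. [cite: Balaban1982Higgs2, (2.89) p.575] -/
def oneSub {X Y : Type*} (ζ : Matrix X Y ℝ) : Matrix X Y ℝ := Matrix.of fun x y => 1 - ζ x y

omit [Fintype ι] [Fintype κ] [Fintype ν] [DecidableEq ι] [DecidableEq κ] [DecidableEq ν] in
/-- Entries of `1 − ζ`. KERNEL (unfolding). [cite: Balaban1982Higgs2, (2.89) p.575] -/
@[simp] theorem oneSub_apply {X Y : Type*} (ζ : Matrix X Y ℝ) (x : X) (y : Y) : oneSub ζ x y = 1 - ζ x y := rfl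

/-- **δC^{(k)}_Λ** of part I (2.35): `δC^{(k)}_Λ = C^{(k)}_Λ − C^{(k)}` as operators on the configurations over `Λ` — the
kernel `(C_Λ − C)(y, y′)` for `y, y′ ∈ Λ`, zero elsewhere (`CΛ` ↤ `C^{(k)}_Λ` extended by zero, `C` ↤ `C^{(k)}`).
[cite: Balaban1982Higgs1, (2.35) p.611] -/
def deltaC (Λ : Finset κ) (CΛ C : Matrix κ κ ℝ) : Matrix κ κ ℝ :=
  Matrix.of fun y y' => if y ∈ Λ ∧ y' ∈ Λ then CΛ y y' - C y y' else 0

omit [Fintype ι] [Fintype κ] [Fintype ν] [DecidableEq ι] [DecidableEq ν] in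
/-- Entries of `δC^{(k)}_Λ`. KERNEL (unfolding). [cite: Balaban1982Higgs1, (2.35) p.611] -/
theorem deltaC_apply (Λ : Finset κ) (CΛ C : Matrix κ κ ℝ) (y y' : κ) :
    deltaC Λ CΛ C y y' = if y ∈ Λ ∧ y' ∈ Λ then CΛ y y' - C y y' else 0 := rfl

variable (S : B1RG242.StepData ℝ ι κ ν)

/-- **A^{(k)} = a_kζ^{(k)}G_kQ_k^*A** ((2.44) p. 566 on the unit lattice of the step, as in (2.88)): the entrywise cut-off
`ζ^{(k)} ⊙ (G_kQ_k^*)` applied to the unit-lattice field `A`, times `a_k` (`S.α`). [cite: Balaban1982Higgs2, (2.88) p.575] -/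
noncomputable def Ak (ζ : Matrix ι κ ℝ) (A : κ → ℝ) : ι → ℝ := S.α • ((ζ ⊙ (S.Gk * S.Qks)) *ᵥ A)

/-- **B^{(k+1),η} = a_{k+1}L⁻²ζ^{(k+1)}G^η_{k+1}Q*_{k+1}B** (the fifth term of (2.89) without `θ_{k+1}`; (2.44) one scale up,
before the rescaling: coefficient `a_{k+1}L⁻² = S.γ` by (I.2.13)). [cite: Balaban1982Higgs2, (2.89) p.575] -/
noncomputable def Bnext (ζ' : Matrix ι ν ℝ) (B : ν → ℝ) : ι → ℝ := S.γ • ((ζ' ⊙ (S.Gk1 * S.Qk1s)) *ᵥ B)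

/-- **B̃^{(k)}** (2.89) p. 575: *"by the definition B̃^{(k)} is the sum of the second, third and fourth terms on the right side
of (2.89)"* — `a_kaL⁻²θ_{k+1}ζ^{(k)}G_kQ_k^*δC^{(k)}_{Λ₀}Q*B − a_kaL⁻²θ_{k+1}(1 − ζ^{(k)})G_kQ_k^*C^{(k)}Q*Λ₀′B +
a_{k+1}L⁻²θ_{k+1}(1 − ζ^{(k+1)})G^η_{k+1}Q*_{k+1}Λ₀′B`, pointwise in `x`. [cite: Balaban1982Higgs2, (2.89) p.575] -/
noncomputable def bTilde (ζ : Matrix ι κ ℝ) (ζ' : Matrix ι ν ℝ) (θ' : ι → ℝ) (Λ₀ : Finset κ) (Λ₀' : Finset ν)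
    (CΛ : Matrix κ κ ℝ) (B : ν → ℝ) : ι → ℝ := fun x =>
  θ' x * ((S.α * S.β) * ((ζ ⊙ (S.Gk * S.Qks)) *ᵥ (deltaC Λ₀ CΛ S.Ck *ᵥ (S.Qs *ᵥ B))) x)
  - θ' x * ((S.α * S.β) * ((oneSub ζ ⊙ (S.Gk * S.Qks)) *ᵥ (S.Ck *ᵥ (S.Qs *ᵥ restrict Λ₀' B))) x)
  + θ' x * (S.γ * ((oneSub ζ' ⊙ (S.Gk1 * S.Qk1s)) *ᵥ restrict Λ₀' B) x)

omit [Fintype ν] [DecidableEq κ] [DecidableEq ν] in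
/-- Pointwise form: `A^{(k)}(x) = a_kΣ_yζ^{(k)}(x,y)(G_kQ_k^*)(x,y)A(y)`. KERNEL. [cite: Balaban1982Higgs2, (2.88) p.575] -/
theorem Ak_apply (ζ : Matrix ι κ ℝ) (A : κ → ℝ) (x : ι) :
    Ak S ζ A x = S.α * ∑ y, ζ x y * (S.Gk * S.Qks) x y * A y := by
  simp [Ak, Matrix.mulVec, dotProduct, Matrix.hadamard_apply]

/-! ### Kernel lemmas for the entrywise cut-off -/

omit [Fintype ι] [Fintype κ] [Fintype ν] [DecidableEq ι] [DecidableEq κ] [DecidableEq ν] in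
/-- `((ζ ⊙ M)v)(x) = Σ_yζ(x,y)M(x,y)v(y)`. KERNEL. [cite: Balaban1982Higgs2, (2.44) p.566] -/
theorem hadamard_mulVec_apply {X Y : Type*} [Fintype Y] (ζ M : Matrix X Y ℝ) (v : Y → ℝ) (x : X) :
    ((ζ ⊙ M) *ᵥ v) x = ∑ y, ζ x y * M x y * v y := by
  simp [Matrix.mulVec, dotProduct, Matrix.hadamard_apply]

omit [Fintype ι] [Fintype κ] [Fintype ν] [DecidableEq ι] [DecidableEq κ] [DecidableEq ν] in
/-- `ζ𝒢 + (1 − ζ)𝒢 = 𝒢` (entrywise). KERNEL. [cite: Balaban1982Higgs2, (2.89) p.575] -/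
theorem hadamard_add_oneSub {X Y : Type*} (ζ M : Matrix X Y ℝ) : ζ ⊙ M + oneSub ζ ⊙ M = M := by
  ext x y
  simp [Matrix.hadamard_apply]
  ring

omit [Fintype ι] [Fintype κ] [Fintype ν] [DecidableEq ι] [DecidableEq κ] [DecidableEq ν] in
/-- `((ζ𝒢)v)(x) + (((1 − ζ)𝒢)v)(x) = (𝒢v)(x)`. KERNEL. [cite: Balaban1982Higgs2, (2.89) p.575] -/
theorem hadamard_mulVec_add_oneSub {X Y : Type*} [Fintype Y] (ζ M : Matrix X Y ℝ) (v : Y → ℝ) (x : X) :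
    ((ζ ⊙ M) *ᵥ v) x + ((oneSub ζ ⊙ M) *ᵥ v) x = (M *ᵥ v) x := by
  rw [← Pi.add_apply, ← Matrix.add_mulVec, hadamard_add_oneSub]

omit [Fintype ι] [Fintype κ] [Fintype ν] [DecidableEq ι] [DecidableEq κ] [DecidableEq ν] in
/-- What the cut-off does not see does not matter: if `v = w` wherever `ζ(x, ·) ≠ 0` then `((ζ𝒢)v)(x) = ((ζ𝒢)w)(x)`.
KERNEL. [cite: Balaban1982Higgs2, (2.89) p.575] -/
theorem hadamard_mulVec_congr {X Y : Type*} [Fintype Y] (ζ M : Matrix X Y ℝ) {v w : Y → ℝ} {x : X}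
    (h : ∀ y, ζ x y ≠ 0 → v y = w y) : ((ζ ⊙ M) *ᵥ v) x = ((ζ ⊙ M) *ᵥ w) x := by
  rw [hadamard_mulVec_apply, hadamard_mulVec_apply]
  refine Finset.sum_congr rfl fun y _ => ?_
  by_cases hζ : ζ x y = 0
  · rw [hζ]; ring
  · rw [h y hζ]

omit [Fintype ι] [Fintype κ] [DecidableEq ι] [DecidableEq κ] in
/-- Off `Λ₀` the block adjoint of `Λ₀′B` vanishes: `(Q*Λ₀′B)(y′) = 0` for `y′ ∉ Λ₀` (block structure `hQ0`).
[cite: Balaban1982Higgs2, (2.89) p.575] -/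
theorem Qs_restrict_eq_zero {Qs : Matrix κ ν ℝ} {Λ₀ : Finset κ} {Λ₀' : Finset ν}
    (hQ0 : ∀ y z, Qs y z ≠ 0 → (y ∈ Λ₀ ↔ z ∈ Λ₀')) (B : ν → ℝ) {y' : κ} (hy' : y' ∉ Λ₀) :
    (Qs *ᵥ restrict Λ₀' B) y' = 0 := by
  change ∑ z, Qs y' z * restrict Λ₀' B z = 0
  refine Finset.sum_eq_zero fun z _ => ?_
  by_cases hQ : Qs y' z = 0
  · rw [hQ, zero_mul]
  · have hz : z ∉ Λ₀' := fun hz => hy' ((hQ0 y' z hQ).2 hz)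
    rw [show restrict Λ₀' B z = 0 from if_neg hz, mul_zero]

omit [Fintype ι] [DecidableEq ι] in
/-- **(I.2.35) read on the rows of `Λ₀`**: for `y ∈ Λ₀`, `(C^{(k)}_{Λ₀}Q*B)(y) = (δC^{(k)}_{Λ₀}Q*B)(y) + (C^{(k)}Q*Λ₀′B)(y)`
— the Dirichlet covariance lives on `Λ₀ × Λ₀` (`hCs`) and `Λ₀(Q*B) = Q*Λ₀′B` (`hQ0`). KERNEL.
[cite: Balaban1982Higgs2, (2.89) p.575] -/
theorem CΛ_mulVec_split {CΛ C : Matrix κ κ ℝ} {Qs : Matrix κ ν ℝ} {Λ₀ : Finset κ} {Λ₀' : Finset ν}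
    (hCs : ∀ y y', CΛ y y' ≠ 0 → y ∈ Λ₀ ∧ y' ∈ Λ₀) (hQ0 : ∀ y z, Qs y z ≠ 0 → (y ∈ Λ₀ ↔ z ∈ Λ₀'))
    (B : ν → ℝ) {y : κ} (hy : y ∈ Λ₀) :
    (CΛ *ᵥ (Qs *ᵥ B)) y = (deltaC Λ₀ CΛ C *ᵥ (Qs *ᵥ B)) y + (C *ᵥ (Qs *ᵥ restrict Λ₀' B)) y := by
  change ∑ y', CΛ y y' * (Qs *ᵥ B) y' = ∑ y', deltaC Λ₀ CΛ C y y' * (Qs *ᵥ B) y' + ∑ y', C y y' * (Qs *ᵥ restrict Λ₀' B) y'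
  rw [← Finset.sum_add_distrib]
  refine Finset.sum_congr rfl fun y' _ => ?_
  rw [deltaC_apply]
  by_cases hy' : y' ∈ Λ₀
  · rw [if_pos ⟨hy, hy'⟩, ← Qs_mulVec_eq_restrict hQ0 B hy']
    ring
  · have h0 : CΛ y y' = 0 := by
      by_contra h
      exact hy' (hCs y y' h).2
    rw [if_neg (fun h => hy' h.2), h0, Qs_restrict_eq_zero hQ0 B hy']
    ring

end Objects

section Bridge244

variable {ι κ ν : Type} [Fintype ι] [Fintype κ] [DecidableEq ι] (S : B1RG242.StepData ℝ ι κ ν)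

/-- `A^{(k)}` IS r14's (2.44) `B2StepK.bg244` at unit spacing (`ℓ = 1`; r14's carrier lives in `Type`). KERNEL.
[cite: Balaban1982Higgs2, (2.44) p.566] -/
theorem Ak_eq_bg244 (ζ : Matrix ι κ ℝ) (A : κ → ℝ) : Ak S ζ A = B2StepK.bg244 S.α 1 ζ (S.Gk * S.Qks) A := by
  simp [Ak, B2StepK.bg244]

end Bridge244

/-! ## §2 **(2.88)**, **(2.89)** p. 575 and the last line of **(2.93)** p. 576 — EXACT -/

section Decomposition

variable {ι κ ν : Type*} [Fintype ι] [Fintype κ] [Fintype ν] [DecidableEq ι] [DecidableEq κ] [DecidableEq ν]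
variable (S : B1RG242.StepData ℝ ι κ ν)

omit [DecidableEq κ] [DecidableEq ν] in
/-- The translated field of (2.80)/(2.110) inside `A^{(k)}`: `A^{(k)}` of `A′ + aL⁻²C_{Λ₀}Q*B` is `A^{(k)}` of r02's
`transl223 (aL⁻²) C_{Λ₀} Q* A′ B` (= r14's `transl2110`, = the seat's (2.80)). KERNEL (definitional).
[cite: Balaban1982Higgs2, (2.80) p.574] -/
theorem Ak_transl (ζ : Matrix ι κ ℝ) (CΛ : Matrix κ κ ℝ) (A' : κ → ℝ) (B : ν → ℝ) :
    Ak S ζ (A' + S.β • (CΛ *ᵥ (S.Qs *ᵥ B))) = Ak S ζ (B2Eq224FirstStepFields.transl223 S.β CΛ S.Qs A' B) := rfl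

omit [DecidableEq κ] [DecidableEq ν] in
/-- **(2.88)** p. 575: `(1 − θ_{k+1})θ_kA^{(k)} = a_k(1 − θ_{k+1})θ_kζ^{(k)}G_kQ_k^*(A′ + aL⁻²C^{(k)}_{Λ₀^{(k)}}Q*B)` — the
definition of `A^{(k)}` on the translated field, multiplied pointwise by `(1 − θ_{k+1})θ_k`. KERNEL (unfolding).
[cite: Balaban1982Higgs2, (2.88) p.575] -/
theorem eq288 (ζ : Matrix ι κ ℝ) (θ θ' : ι → ℝ) (CΛ : Matrix κ κ ℝ) (A' : κ → ℝ) (B : ν → ℝ) (x : ι) :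
    (1 - θ' x) * θ x * Ak S ζ (A' + S.β • (CΛ *ᵥ (S.Qs *ᵥ B))) x
      = S.α * ((1 - θ' x) * θ x) * ((ζ ⊙ (S.Gk * S.Qks)) *ᵥ (A' + S.β • (CΛ *ᵥ (S.Qs *ᵥ B)))) x := by
  simp only [Ak, Pi.smul_apply, smul_eq_mul]
  ring

/-- (I.2.41) as used in (2.89): `a_kaL⁻²(G_kQ_k^*C^{(k)}Q*w)(x) = a_{k+1}L⁻²(G^η_{k+1}Q*_{k+1}w)(x)` for every block field `w`
— `B1Eq333Decomposition.eq342_op` applied to `w`. [cite: Balaban1982Higgs1, (2.41) p.612] -/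
theorem recursive_apply (hQ : S.Q * S.Qs = 1) (hαβ : S.α + S.β ≠ 0) (hG : IsUnit (S.H + S.α • S.Pk))
    (hC : IsUnit (S.β • S.P + S.Δk)) (w : ν → ℝ) (x : ι) :
    S.α * S.β * ((S.Gk * S.Qks) *ᵥ (S.Ck *ᵥ (S.Qs *ᵥ w))) x = S.γ * ((S.Gk1 * S.Qk1s) *ᵥ w) x := by
  have hop := B1Eq333Decomposition.eq342_op S hQ hαβ hG hC
  have h := congrArg (fun M : Matrix ι ν ℝ => (M *ᵥ w) x) hop
  simp only [Matrix.smul_mulVec, Pi.smul_apply, smul_eq_mul, ← Matrix.mulVec_mulVec] at h ⊢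
  exact h

/-- **The exact discrepancy of the five printed terms** (no cut-off geometry assumed for `ζ^{(k+1)}`): under (I.2.41), the
Dirichlet support of `C_{Λ₀}`, the block structure of `Q*` and `supp θ_{k+1}ζ^{(k)}(x,·) ⊆ Λ₀` (`hθζ`), the sum of the five
terms of (2.89) MINUS `θ_{k+1}A^{(k)}(x)` equals `a_{k+1}L⁻²θ_{k+1}(x)((ζ^{(k+1)}G^η_{k+1}Q*_{k+1})(B − Λ₀′B))(x)` — the part of
`B` off `Λ₀′` seen through `θ_{k+1}ζ^{(k+1)}`. KERNEL. [cite: Balaban1982Higgs2, (2.89) p.575] -/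
theorem eq289_defect (hQ : S.Q * S.Qs = 1) (hαβ : S.α + S.β ≠ 0) (hG : IsUnit (S.H + S.α • S.Pk))
    (hC : IsUnit (S.β • S.P + S.Δk)) {ζ : Matrix ι κ ℝ} (ζ' : Matrix ι ν ℝ) {θ' : ι → ℝ} {Λ₀ : Finset κ}
    {Λ₀' : Finset ν} {CΛ : Matrix κ κ ℝ} (hCs : ∀ y y', CΛ y y' ≠ 0 → y ∈ Λ₀ ∧ y' ∈ Λ₀)
    (hQ0 : ∀ y z, S.Qs y z ≠ 0 → (y ∈ Λ₀ ↔ z ∈ Λ₀')) (hθζ : ∀ x y, θ' x ≠ 0 → ζ x y ≠ 0 → y ∈ Λ₀)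
    (A' : κ → ℝ) (B : ν → ℝ) (x : ι) :
    (θ' x * Ak S ζ A' x + bTilde S ζ ζ' θ' Λ₀ Λ₀' CΛ B x + θ' x * Bnext S ζ' B x)
      - θ' x * Ak S ζ (A' + S.β • (CΛ *ᵥ (S.Qs *ᵥ B))) x
      = θ' x * (S.γ * ((ζ' ⊙ (S.Gk1 * S.Qk1s)) *ᵥ (B - restrict Λ₀' B)) x) := by
  by_cases hθ : θ' x = 0
  · simp [bTilde, hθ]
  -- abbreviations
  set GQ : Matrix ι κ ℝ := S.Gk * S.Qks with hGQ
  set GQ₁ : Matrix ι ν ℝ := S.Gk1 * S.Qk1s with hGQ₁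
  set w : ν → ℝ := restrict Λ₀' B with hw
  -- (1) linearity of A^{(k)} in the field
  have h1 : Ak S ζ (A' + S.β • (CΛ *ᵥ (S.Qs *ᵥ B))) x
      = Ak S ζ A' x + S.α * S.β * ((ζ ⊙ GQ) *ᵥ (CΛ *ᵥ (S.Qs *ᵥ B))) x := by
    simp only [Ak, Matrix.mulVec_add, Matrix.mulVec_smul, Pi.add_apply, Pi.smul_apply, smul_eq_mul]
    ring
  -- (2) on the rows seen by θ_{k+1}ζ^{(k)}(x,·): C_{Λ₀}Q*B = δC_{Λ₀}Q*B + CQ*Λ₀′B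
  have h2 : ((ζ ⊙ GQ) *ᵥ (CΛ *ᵥ (S.Qs *ᵥ B))) x
      = ((ζ ⊙ GQ) *ᵥ (deltaC Λ₀ CΛ S.Ck *ᵥ (S.Qs *ᵥ B))) x + ((ζ ⊙ GQ) *ᵥ (S.Ck *ᵥ (S.Qs *ᵥ w))) x := by
    rw [← Pi.add_apply, ← Matrix.mulVec_add]
    refine hadamard_mulVec_congr ζ GQ fun y hy => ?_
    rw [Pi.add_apply]
    exact CΛ_mulVec_split hCs hQ0 B (hθζ x y hθ hy)
  -- (3) ζ𝒢 = 𝒢 − (1 − ζ)𝒢 on CQ*Λ₀′B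
  have h3 : ((ζ ⊙ GQ) *ᵥ (S.Ck *ᵥ (S.Qs *ᵥ w))) x
      = (GQ *ᵥ (S.Ck *ᵥ (S.Qs *ᵥ w))) x - ((oneSub ζ ⊙ GQ) *ᵥ (S.Ck *ᵥ (S.Qs *ᵥ w))) x := by
    rw [← hadamard_mulVec_add_oneSub ζ GQ]
    ring
  -- (4) the recursive equation (I.2.41) on Λ₀′B
  have h4 : S.α * S.β * (GQ *ᵥ (S.Ck *ᵥ (S.Qs *ᵥ w))) x = S.γ * (GQ₁ *ᵥ w) x :=
    recursive_apply S hQ hαβ hG hC w x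
  -- (5) 𝒢₁ = (1 − ζ′)𝒢₁ + ζ′𝒢₁ on Λ₀′B
  have h5 : (GQ₁ *ᵥ w) x = ((oneSub ζ' ⊙ GQ₁) *ᵥ w) x + ((ζ' ⊙ GQ₁) *ᵥ w) x := by
    rw [← hadamard_mulVec_add_oneSub ζ' GQ₁]
    ring
  -- (6) ζ′𝒢₁(B − Λ₀′B) = ζ′𝒢₁B − ζ′𝒢₁Λ₀′B
  have h6 : ((ζ' ⊙ GQ₁) *ᵥ (B - w)) x = ((ζ' ⊙ GQ₁) *ᵥ B) x - ((ζ' ⊙ GQ₁) *ᵥ w) x := by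
    rw [Matrix.mulVec_sub, Pi.sub_apply]
  simp only [bTilde, Bnext, Pi.smul_apply, smul_eq_mul]
  rw [h1, h2, h3, h6]
  linear_combination (-(θ' x)) * h4 + (-(θ' x * S.γ)) * h5

/-- **(2.89)** p. 575, EXACT: `θ_{k+1}A^{(k)} = θ_{k+1}A′^{(k)} + B̃^{(k)} + θ_{k+1}B^{(k+1),η}` pointwise, for the translated
field `A′ + aL⁻²C^{(k)}_{Λ₀}Q*B` of (2.80), under: the recursive equation (I.2.41) (part I's `StepData` hypotheses `hQ`, `hαβ`,
`hG`, `hC`), the Dirichlet support of `C^{(k)}_{Λ₀}` (`hCs`), the block structure of `Q*` (`hQ0`), and the two support facts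
the cut-offs provide — `θ_{k+1}ζ^{(k)}(x, ·)` sees only `Λ₀` (`hθζ`) and `θ_{k+1}ζ^{(k+1)}(x, ·)` sees only `Λ₀′` (`hθζ'`, the
finite range of `ζ^{(k+1)}` against the `2r(Lᵏε)`-collar of (2.8); see the module docstring's reading note).
[cite: Balaban1982Higgs2, (2.89) p.575] -/
theorem eq289 (hQ : S.Q * S.Qs = 1) (hαβ : S.α + S.β ≠ 0) (hG : IsUnit (S.H + S.α • S.Pk))
    (hC : IsUnit (S.β • S.P + S.Δk)) {ζ : Matrix ι κ ℝ} {ζ' : Matrix ι ν ℝ} {θ' : ι → ℝ} {Λ₀ : Finset κ}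
    {Λ₀' : Finset ν} {CΛ : Matrix κ κ ℝ} (hCs : ∀ y y', CΛ y y' ≠ 0 → y ∈ Λ₀ ∧ y' ∈ Λ₀)
    (hQ0 : ∀ y z, S.Qs y z ≠ 0 → (y ∈ Λ₀ ↔ z ∈ Λ₀')) (hθζ : ∀ x y, θ' x ≠ 0 → ζ x y ≠ 0 → y ∈ Λ₀)
    (hθζ' : ∀ x z, θ' x ≠ 0 → ζ' x z ≠ 0 → z ∈ Λ₀') (A' : κ → ℝ) (B : ν → ℝ) (x : ι) :
    θ' x * Ak S ζ (A' + S.β • (CΛ *ᵥ (S.Qs *ᵥ B))) x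
      = θ' x * Ak S ζ A' x + bTilde S ζ ζ' θ' Λ₀ Λ₀' CΛ B x + θ' x * Bnext S ζ' B x := by
  have hd := eq289_defect S hQ hαβ hG hC ζ' hCs hQ0 hθζ A' B x
  have h0 : θ' x * (S.γ * ((ζ' ⊙ (S.Gk1 * S.Qk1s)) *ᵥ (B - restrict Λ₀' B)) x) = 0 := by
    by_cases hθ : θ' x = 0
    · rw [hθ, zero_mul]
    · have : ((ζ' ⊙ (S.Gk1 * S.Qk1s)) *ᵥ (B - restrict Λ₀' B)) x = ((ζ' ⊙ (S.Gk1 * S.Qk1s)) *ᵥ (0 : ν → ℝ)) x := by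
        refine hadamard_mulVec_congr ζ' _ fun z hz => ?_
        have hzΛ : z ∈ Λ₀' := hθζ' x z hθ hz
        simp [restrict, hzΛ]
      rw [this, Matrix.mulVec_zero, Pi.zero_apply, mul_zero, mul_zero]
  rw [h0] at hd
  linarith

/-- **(2.93) p. 576, last line** — the field entering the next step: where `θ_k = 1` on the support of `θ_{k+1}` (`hθθ'`:
`θ_k ≡ 1` on `B^{k−1}(Λ₂^{(k−1)}) ⊇` the `M`-neighbourhood of `Bᵏ(Λ₂^{(k)})`), `θ_kA^{(k)} = (1 − θ_{k+1})θ_kA^{(k)} +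
θ_{k+1}B^{(k+1),η} + (θ_{k+1}A′^{(k)} + B̃^{(k)})` — r14's two-scale field `B2IndStep2115.bTilde582` = `B2Sect2BDensities.aTilde245`
of `(θ_{k+1}, θ_k, A^{(k)}, B^{(k+1),η})` plus the small field of (2.94). [cite: Balaban1982Higgs2, (2.93) p.576] -/
theorem eq293_last (hQ : S.Q * S.Qs = 1) (hαβ : S.α + S.β ≠ 0) (hG : IsUnit (S.H + S.α • S.Pk))
    (hC : IsUnit (S.β • S.P + S.Δk)) {ζ : Matrix ι κ ℝ} {ζ' : Matrix ι ν ℝ} {θ θ' : ι → ℝ} {Λ₀ : Finset κ}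
    {Λ₀' : Finset ν} {CΛ : Matrix κ κ ℝ} (hCs : ∀ y y', CΛ y y' ≠ 0 → y ∈ Λ₀ ∧ y' ∈ Λ₀)
    (hQ0 : ∀ y z, S.Qs y z ≠ 0 → (y ∈ Λ₀ ↔ z ∈ Λ₀')) (hθζ : ∀ x y, θ' x ≠ 0 → ζ x y ≠ 0 → y ∈ Λ₀)
    (hθζ' : ∀ x z, θ' x ≠ 0 → ζ' x z ≠ 0 → z ∈ Λ₀') (hθθ' : ∀ x, θ' x ≠ 0 → θ x = 1)
    (A' : κ → ℝ) (B : ν → ℝ) (x : ι) :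
    θ x * Ak S ζ (A' + S.β • (CΛ *ᵥ (S.Qs *ᵥ B))) x
      = B2Sect2BDensities.aTilde245 θ' θ (Ak S ζ (A' + S.β • (CΛ *ᵥ (S.Qs *ᵥ B)))) (Bnext S ζ' B) x
        + (θ' x * Ak S ζ A' x + bTilde S ζ ζ' θ' Λ₀ Λ₀' CΛ B x) := by
  have h89 := eq289 S hQ hαβ hG hC hCs hQ0 hθζ hθζ' A' B x
  simp only [B2Sect2BDensities.aTilde245, smul_eq_mul]
  by_cases hθ : θ' x = 0
  · have hb : bTilde S ζ ζ' θ' Λ₀ Λ₀' CΛ B x = 0 := by simp [bTilde, hθ]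
    rw [hθ, hb]
    ring
  · rw [hθθ' x hθ] at *
    linear_combination h89

end Decomposition

/-! ## §3 **(2.90)** `B̃^{(k)}(x) = O((Lᵏε)^κ)` and **(2.91)** — from the printed shapes -/

section Smallness

variable {ι κ ν : Type*} [Fintype ι] [Fintype κ] [Fintype ν] [DecidableEq ι] [DecidableEq κ] [DecidableEq ν]

omit [Fintype ι] [Fintype κ] [Fintype ν] [DecidableEq ι] [DecidableEq κ] [DecidableEq ν] in
/-- FAR-KERNEL engine: if the kernel itself vanishes near (`K(y) ≠ 0 ⇒ R ≤ d(y)`), `|K| ≤ c₀e^{−δd}`, `|g| ≤ G` and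
`Σe^{−½δd} ≤ S`, then `|Σ_yK(y)g(y)| ≤ c₀e^{−½δR}·G·S` (p23's `far_sum_bound` with the far-ness moved to the kernel).
[cite: Balaban1982Higgs2, (2.90) p.575] -/
theorem far_kernel_sum_bound {Y : Type*} {T : Finset Y} {K g d : Y → ℝ} {c₀ δ R G Ssum : ℝ} (hc₀ : 0 ≤ c₀)
    (hδ : 0 ≤ δ) (hG : 0 ≤ G) (hK : ∀ y ∈ T, |K y| ≤ c₀ * Real.exp (-(δ * d y)))
    (hfar : ∀ y ∈ T, K y ≠ 0 → R ≤ d y) (hg : ∀ y ∈ T, |g y| ≤ G)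
    (hS : ∑ y ∈ T, Real.exp (-(δ / 2 * d y)) ≤ Ssum) :
    |∑ y ∈ T, K y * g y| ≤ c₀ * Real.exp (-(δ / 2 * R)) * G * Ssum := by
  classical
  set g' : Y → ℝ := fun y => if K y = 0 then 0 else g y with hg'
  have heq : ∑ y ∈ T, K y * g y = ∑ y ∈ T, K y * g' y := by
    refine Finset.sum_congr rfl fun y _ => ?_
    by_cases hK0 : K y = 0
    · simp [hg', hK0]
    · simp [hg', hK0]
  rw [heq]
  refine far_sum_bound hc₀ hδ hG hK (fun y hy hgy => ?_) (fun y hy => ?_) hS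
  · by_cases hK0 : K y = 0
    · exact absurd (by simp [hg', hK0]) hgy
    · exact hfar y hy hK0
  · by_cases hK0 : K y = 0
    · simp [hg', hK0, hG]
    · simpa [hg', hK0] using hg y hy

variable (S : B1RG242.StepData ℝ ι κ ν)

omit [Fintype ι] [DecidableEq ι] in
/-- **TERM 2, row-damped**: `|Σ_yζ(x,y)𝒢(x,y)(δC_{Λ₀}Q*B)(y)| ≤ c₁S₁·c₀e^{−δ₀R₂}·qs₁G·S₂` when every row `y` seen by
`θ_{k+1}ζ^{(k)}(x, ·)` lies `≥ R₂` inside `Λ₀` (`hdeep`), `δC_{Λ₀}` has the (I.2.36) shape, `|𝒢(x,y)| ≤ c₁e^{−δ₀d₁(x,y)}`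
((2.58)), `0 ≤ ζ ≤ 1`, `Q*` has row sums `≤ qs₁` and block structure, `|B| ≤ G` on `Λ₀′` ((2.17)).
[cite: Balaban1982Higgs2, (2.90) p.575] -/
theorem term2_bound {GQ : Matrix ι κ ℝ} {ζ : Matrix ι κ ℝ} {CΛ C : Matrix κ κ ℝ} {Qs : Matrix κ ν ℝ}
    {Λ₀ : Finset κ} {Λ₀' : Finset ν} {B : ν → ℝ} {x : ι} {d₁ : ι → κ → ℝ} {d₂ : κ → κ → ℝ} {u : κ → ℝ}
    {c₀ c₁ δ R₂ G qs₁ S₁ S₂ : ℝ} (hc₀ : 0 ≤ c₀) (hc₁ : 0 ≤ c₁) (hδ : 0 ≤ δ) (hG : 0 ≤ G) (hqs : 0 ≤ qs₁)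
    (hS₂0 : 0 ≤ S₂) (hd₁ : ∀ y, 0 ≤ d₁ x y) (hd₂ : ∀ y y', 0 ≤ d₂ y y') (hu0 : ∀ y, 0 ≤ u y)
    (hζ01 : ∀ y, 0 ≤ ζ x y ∧ ζ x y ≤ 1) (hdeep : ∀ y, ζ x y ≠ 0 → y ∈ Λ₀ ∧ R₂ ≤ u y)
    (hGQ : ∀ y, |GQ x y| ≤ c₁ * Real.exp (-(δ * d₁ x y)))
    (hδC : ∀ y ∈ Λ₀, ∀ y' ∈ Λ₀, |CΛ y y' - C y y'| ≤ c₀ * Real.exp (-(δ * (d₂ y y' + u y + u y'))))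
    (hQ0 : ∀ y z, Qs y z ≠ 0 → (y ∈ Λ₀ ↔ z ∈ Λ₀')) (hqs₁ : ∀ y, ∑ z, |Qs y z| ≤ qs₁)
    (hB : ∀ z ∈ Λ₀', |B z| ≤ G) (hS₁ : ∑ y, Real.exp (-(δ / 4 * d₁ x y)) ≤ S₁)
    (hS₂ : ∀ y, ∑ y', Real.exp (-(δ / 4 * d₂ y y')) ≤ S₂) :
    |((ζ ⊙ GQ) *ᵥ (deltaC Λ₀ CΛ C *ᵥ (Qs *ᵥ B))) x| ≤ c₁ * S₁ * (c₀ * Real.exp (-(δ * R₂)) * (qs₁ * G) * S₂) := by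
  rw [hadamard_mulVec_apply]
  -- the inner vector, on the rows that matter
  have hinner : ∀ y, ζ x y ≠ 0 →
      |(deltaC Λ₀ CΛ C *ᵥ (Qs *ᵥ B)) y| ≤ c₀ * Real.exp (-(δ * R₂)) * (qs₁ * G) * S₂ := by
    intro y hy
    obtain ⟨hyΛ, hR⟩ := hdeep y hy
    change |∑ y', deltaC Λ₀ CΛ C y y' * (Qs *ᵥ B) y'| ≤ _
    have hterm : ∀ y', |deltaC Λ₀ CΛ C y y' * (Qs *ᵥ B) y'|
        ≤ (c₀ * Real.exp (-(δ * R₂)) * (qs₁ * G)) * Real.exp (-(δ * d₂ y y')) := by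
      intro y'
      rw [deltaC_apply]
      by_cases hy' : y' ∈ Λ₀
      · rw [if_pos ⟨hyΛ, hy'⟩, abs_mul, Qs_mulVec_eq_restrict hQ0 B hy']
        have hq : |(Qs *ᵥ restrict Λ₀' B) y'| ≤ qs₁ * G := abs_Qs_restrict_le hG hB hqs₁ y'
        have hk : |CΛ y y' - C y y'| ≤ c₀ * Real.exp (-(δ * R₂)) * Real.exp (-(δ * d₂ y y')) := by
          refine (hδC y hyΛ y' hy').trans ?_
          rw [mul_assoc, ← Real.exp_add]
          refine mul_le_mul_of_nonneg_left ?_ hc₀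
          rw [Real.exp_le_exp]
          have := hu0 y'
          have := hd₂ y y'
          nlinarith
        calc |CΛ y y' - C y y'| * |(Qs *ᵥ restrict Λ₀' B) y'|
            ≤ (c₀ * Real.exp (-(δ * R₂)) * Real.exp (-(δ * d₂ y y'))) * (qs₁ * G) :=
              mul_le_mul hk hq (abs_nonneg _) (by positivity)
          _ = (c₀ * Real.exp (-(δ * R₂)) * (qs₁ * G)) * Real.exp (-(δ * d₂ y y')) := by ring
      · rw [if_neg (fun h => hy' h.2), zero_mul, abs_zero]
        positivity
    have hsum : ∑ y', Real.exp (-(δ * d₂ y y')) ≤ S₂ :=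
      sum_exp_le_of_rate (by linarith) (fun y' _ => hd₂ y y') (hS₂ y)
    calc |∑ y', deltaC Λ₀ CΛ C y y' * (Qs *ᵥ B) y'|
        ≤ ∑ y', |deltaC Λ₀ CΛ C y y' * (Qs *ᵥ B) y'| := Finset.abs_sum_le_sum_abs _ _
      _ ≤ ∑ y', (c₀ * Real.exp (-(δ * R₂)) * (qs₁ * G)) * Real.exp (-(δ * d₂ y y')) :=
          Finset.sum_le_sum fun y' _ => hterm y'
      _ = (c₀ * Real.exp (-(δ * R₂)) * (qs₁ * G)) * ∑ y', Real.exp (-(δ * d₂ y y')) := by rw [Finset.mul_sum]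
      _ ≤ (c₀ * Real.exp (-(δ * R₂)) * (qs₁ * G)) * S₂ := mul_le_mul_of_nonneg_left hsum (by positivity)
  -- the outer kernel sum
  have hK : ∀ y ∈ (Finset.univ : Finset κ), |ζ x y * GQ x y| ≤ c₁ * Real.exp (-(δ * d₁ x y)) := by
    intro y _
    rw [abs_mul]
    calc |ζ x y| * |GQ x y| ≤ 1 * (c₁ * Real.exp (-(δ * d₁ x y))) := by
          refine mul_le_mul ?_ (hGQ y) (abs_nonneg _) zero_le_one
          rw [abs_le]; constructor <;> linarith [(hζ01 y).1, (hζ01 y).2]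
      _ = c₁ * Real.exp (-(δ * d₁ x y)) := one_mul _
  calc |∑ y, ζ x y * GQ x y * (deltaC Λ₀ CΛ C *ᵥ (Qs *ᵥ B)) y|
      ≤ ∑ y, |ζ x y * GQ x y * (deltaC Λ₀ CΛ C *ᵥ (Qs *ᵥ B)) y| := Finset.abs_sum_le_sum_abs _ _
    _ ≤ ∑ y, |ζ x y * GQ x y| * (c₀ * Real.exp (-(δ * R₂)) * (qs₁ * G) * S₂) := by
        refine Finset.sum_le_sum fun y _ => ?_
        rw [abs_mul]
        by_cases hy : ζ x y = 0
        · rw [hy, zero_mul, abs_zero, zero_mul, zero_mul]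
        · exact mul_le_mul_of_nonneg_left (hinner y hy) (abs_nonneg _)
    _ = (∑ y, |ζ x y * GQ x y|) * (c₀ * Real.exp (-(δ * R₂)) * (qs₁ * G) * S₂) := by rw [Finset.sum_mul]
    _ ≤ (c₁ * S₁) * (c₀ * Real.exp (-(δ * R₂)) * (qs₁ * G) * S₂) :=
        mul_le_mul_of_nonneg_right (sum_abs_kernel_le hc₁ hδ hK (fun y _ => hd₁ y) hS₁) (by positivity)
    _ = c₁ * S₁ * (c₀ * Real.exp (-(δ * R₂)) * (qs₁ * G) * S₂) := by ring

omit [Fintype ι] [DecidableEq ι] [DecidableEq κ] in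
/-- **TERM 3, far in `𝒢`**: `|Σ_y(1 − ζ(x,y))𝒢(x,y)(C^{(k)}Q*Λ₀′B)(y)| ≤ c₁e^{−½δ₀R₃}·(c₀S₂qs₁G)·S₁` when `1 − ζ^{(k)}(x,y) ≠ 0
⇒ d₁(x,y) ≥ R₃` (`= ½r(Lᵏε)`, p. 566), `|C^{(k)}(y,y′)| ≤ c₀e^{−δ₀d₂}` ((I.2.34)), `|𝒢| ≤ c₁e^{−δ₀d₁}` ((2.58)), `0 ≤ ζ ≤ 1`.
[cite: Balaban1982Higgs2, (2.90) p.575] -/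
theorem term3_bound {GQ : Matrix ι κ ℝ} {ζ : Matrix ι κ ℝ} {C : Matrix κ κ ℝ} {Qs : Matrix κ ν ℝ} {Λ₀' : Finset ν}
    {B : ν → ℝ} {x : ι} {d₁ : ι → κ → ℝ} {d₂ : κ → κ → ℝ} {c₀ c₁ δ R₃ G qs₁ S₁ S₂ : ℝ}
    (hc₀ : 0 ≤ c₀) (hc₁ : 0 ≤ c₁) (hδ : 0 ≤ δ) (hG : 0 ≤ G) (hqs : 0 ≤ qs₁) (hS₂0 : 0 ≤ S₂)
    (hd₁ : ∀ y, 0 ≤ d₁ x y) (hd₂ : ∀ y y', 0 ≤ d₂ y y') (hζ01 : ∀ y, 0 ≤ ζ x y ∧ ζ x y ≤ 1)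
    (hfarζ : ∀ y, ζ x y ≠ 1 → R₃ ≤ d₁ x y) (hGQ : ∀ y, |GQ x y| ≤ c₁ * Real.exp (-(δ * d₁ x y)))
    (hCd : ∀ y y', |C y y'| ≤ c₀ * Real.exp (-(δ * d₂ y y'))) (hqs₁ : ∀ y, ∑ z, |Qs y z| ≤ qs₁)
    (hB : ∀ z ∈ Λ₀', |B z| ≤ G) (hS₁ : ∑ y, Real.exp (-(δ / 4 * d₁ x y)) ≤ S₁)
    (hS₂ : ∀ y, ∑ y', Real.exp (-(δ / 4 * d₂ y y')) ≤ S₂) :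
    |((oneSub ζ ⊙ GQ) *ᵥ (C *ᵥ (Qs *ᵥ restrict Λ₀' B))) x|
      ≤ c₁ * Real.exp (-(δ / 2 * R₃)) * (c₀ * S₂ * (qs₁ * G)) * S₁ := by
  rw [hadamard_mulVec_apply]
  have hg : ∀ y ∈ (Finset.univ : Finset κ), |(C *ᵥ (Qs *ᵥ restrict Λ₀' B)) y| ≤ c₀ * S₂ * (qs₁ * G) := by
    intro y _
    change |∑ y', C y y' * (Qs *ᵥ restrict Λ₀' B) y'| ≤ _
    have hsum : ∑ y', Real.exp (-(δ * d₂ y y')) ≤ S₂ :=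
      sum_exp_le_of_rate (by linarith) (fun y' _ => hd₂ y y') (hS₂ y)
    calc |∑ y', C y y' * (Qs *ᵥ restrict Λ₀' B) y'|
        ≤ ∑ y', |C y y' * (Qs *ᵥ restrict Λ₀' B) y'| := Finset.abs_sum_le_sum_abs _ _
      _ ≤ ∑ y', (c₀ * Real.exp (-(δ * d₂ y y'))) * (qs₁ * G) := by
          refine Finset.sum_le_sum fun y' _ => ?_
          rw [abs_mul]
          exact mul_le_mul (hCd y y') (abs_Qs_restrict_le hG hB hqs₁ y') (abs_nonneg _) (by positivity)
      _ = c₀ * (qs₁ * G) * ∑ y', Real.exp (-(δ * d₂ y y')) := by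
          rw [Finset.mul_sum]; exact Finset.sum_congr rfl fun y' _ => by ring
      _ ≤ c₀ * (qs₁ * G) * S₂ := mul_le_mul_of_nonneg_left hsum (by positivity)
      _ = c₀ * S₂ * (qs₁ * G) := by ring
  have hK : ∀ y ∈ (Finset.univ : Finset κ), |oneSub ζ x y * GQ x y| ≤ c₁ * Real.exp (-(δ * d₁ x y)) := by
    intro y _
    rw [abs_mul, oneSub_apply]
    calc |1 - ζ x y| * |GQ x y| ≤ 1 * (c₁ * Real.exp (-(δ * d₁ x y))) := by
          refine mul_le_mul ?_ (hGQ y) (abs_nonneg _) zero_le_one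
          rw [abs_le]; constructor <;> linarith [(hζ01 y).1, (hζ01 y).2]
      _ = c₁ * Real.exp (-(δ * d₁ x y)) := one_mul _
  have hfar : ∀ y ∈ (Finset.univ : Finset κ), oneSub ζ x y * GQ x y ≠ 0 → R₃ ≤ d₁ x y := by
    intro y _ h
    refine hfarζ y fun h1 => h ?_
    rw [oneSub_apply, h1, sub_self, zero_mul]
  have hS : ∑ y, Real.exp (-(δ / 2 * d₁ x y)) ≤ S₁ :=
    sum_exp_le_of_rate (by linarith) (fun y _ => hd₁ y) hS₁
  exact far_kernel_sum_bound hc₁ hδ (by positivity) hK hfar hg hS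

omit [Fintype ι] [Fintype κ] [DecidableEq ι] [DecidableEq κ] in
/-- **TERM 4, far in `𝒢₁`**: `|Σ_z(1 − ζ′(x,z))𝒢₁(x,z)(Λ₀′B)(z)| ≤ c₁′e^{−½δ₀R₄}·G·S₃` when `1 − ζ^{(k+1)}(x,z) ≠ 0 ⇒ d₁′(x,z)
≥ R₄`, `|𝒢₁(x,z)| ≤ c₁′e^{−δ₀d₁′(x,z)}` (Prop. 2.2 for `G_{k+1}Q*_{k+1}`), `0 ≤ ζ′ ≤ 1`, `|B| ≤ G` on `Λ₀′`.
[cite: Balaban1982Higgs2, (2.90) p.575] -/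
theorem term4_bound {GQ₁ : Matrix ι ν ℝ} {ζ' : Matrix ι ν ℝ} {Λ₀' : Finset ν} {B : ν → ℝ} {x : ι}
    {d₁' : ι → ν → ℝ} {c₁' δ R₄ G S₃ : ℝ} (hc₁ : 0 ≤ c₁') (hδ : 0 ≤ δ) (hG : 0 ≤ G)
    (hd₁ : ∀ z, 0 ≤ d₁' x z) (hζ01 : ∀ z, 0 ≤ ζ' x z ∧ ζ' x z ≤ 1) (hfarζ : ∀ z, ζ' x z ≠ 1 → R₄ ≤ d₁' x z)
    (hGQ₁ : ∀ z, |GQ₁ x z| ≤ c₁' * Real.exp (-(δ * d₁' x z))) (hB : ∀ z ∈ Λ₀', |B z| ≤ G)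
    (hS₃ : ∑ z, Real.exp (-(δ / 4 * d₁' x z)) ≤ S₃) :
    |((oneSub ζ' ⊙ GQ₁) *ᵥ restrict Λ₀' B) x| ≤ c₁' * Real.exp (-(δ / 2 * R₄)) * G * S₃ := by
  rw [hadamard_mulVec_apply]
  have hK : ∀ z ∈ (Finset.univ : Finset ν), |oneSub ζ' x z * GQ₁ x z| ≤ c₁' * Real.exp (-(δ * d₁' x z)) := by
    intro z _
    rw [abs_mul, oneSub_apply]
    calc |1 - ζ' x z| * |GQ₁ x z| ≤ 1 * (c₁' * Real.exp (-(δ * d₁' x z))) := by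
          refine mul_le_mul ?_ (hGQ₁ z) (abs_nonneg _) zero_le_one
          rw [abs_le]; constructor <;> linarith [(hζ01 z).1, (hζ01 z).2]
      _ = c₁' * Real.exp (-(δ * d₁' x z)) := one_mul _
  have hfar : ∀ z ∈ (Finset.univ : Finset ν), oneSub ζ' x z * GQ₁ x z ≠ 0 → R₄ ≤ d₁' x z := by
    intro z _ h
    refine hfarζ z fun h1 => h ?_
    rw [oneSub_apply, h1, sub_self, zero_mul]
  have hg : ∀ z ∈ (Finset.univ : Finset ν), |restrict Λ₀' B z| ≤ G := by
    intro z _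
    unfold restrict
    by_cases hz : z ∈ Λ₀'
    · rw [if_pos hz]; exact hB z hz
    · rw [if_neg hz, abs_zero]; exact hG
  have hS : ∑ z, Real.exp (-(δ / 2 * d₁' x z)) ≤ S₃ :=
    sum_exp_le_of_rate (by linarith) (fun z _ => hd₁ z) hS₃
  exact far_kernel_sum_bound hc₁ hδ hG hK hfar hg hS

/-- **(2.90)** p. 575 — `B̃^{(k)}(x)` bounded from the printed shapes: with the separations `R₂` (how deep inside `Λ₀` the rows
seen by `θ_{k+1}ζ^{(k)}(x,·)` lie), `R₃`, `R₄` (how far `1 − ζ^{(k)}`, `1 − ζ^{(k+1)}` force the kernels to run),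
`|B̃^{(k)}(x)| ≤ (|a_kaL⁻²|·c₀c₁qs₁S₁S₂·(e^{−δ₀R₂} + e^{−½δ₀R₃}) + |a_{k+1}L⁻²|·c₁′S₃·e^{−½δ₀R₄})·G`, `G` the (2.17) threshold for
`|B|` on `Λ₀′` — over part I's `StepData` (`𝒢 = S.Gk * S.Qks`, `C^{(k)} = S.Ck`, `Q* = S.Qs`, `𝒢₁ = S.Gk1 * S.Qk1s`), with
`|θ_{k+1}| ≤ 1`. [cite: Balaban1982Higgs2, (2.90) p.575] -/
theorem bTilde_bound {ζ : Matrix ι κ ℝ} {ζ' : Matrix ι ν ℝ} {θ' : ι → ℝ} {Λ₀ : Finset κ} {Λ₀' : Finset ν}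
    {CΛ : Matrix κ κ ℝ} {B : ν → ℝ} {x : ι} {d₁ : ι → κ → ℝ} {d₁' : ι → ν → ℝ} {d₂ : κ → κ → ℝ} {u : κ → ℝ}
    {c₀ c₁ c₁' δ R₂ R₃ R₄ G qs₁ S₁ S₂ S₃ : ℝ} (hc₀ : 0 ≤ c₀) (hc₁ : 0 ≤ c₁) (hc₁' : 0 ≤ c₁') (hδ : 0 ≤ δ)
    (hG : 0 ≤ G) (hqs : 0 ≤ qs₁) (hS₂0 : 0 ≤ S₂)
    (hd₁ : ∀ y, 0 ≤ d₁ x y) (hd₁' : ∀ z, 0 ≤ d₁' x z) (hd₂ : ∀ y y', 0 ≤ d₂ y y') (hu0 : ∀ y, 0 ≤ u y)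
    (hθ01 : 0 ≤ θ' x ∧ θ' x ≤ 1) (hζ01 : ∀ y, 0 ≤ ζ x y ∧ ζ x y ≤ 1) (hζ'01 : ∀ z, 0 ≤ ζ' x z ∧ ζ' x z ≤ 1)
    (hdeep : θ' x ≠ 0 → ∀ y, ζ x y ≠ 0 → y ∈ Λ₀ ∧ R₂ ≤ u y)
    (hfarζ : ∀ y, ζ x y ≠ 1 → R₃ ≤ d₁ x y) (hfarζ' : ∀ z, ζ' x z ≠ 1 → R₄ ≤ d₁' x z)
    (hGQ : ∀ y, |(S.Gk * S.Qks) x y| ≤ c₁ * Real.exp (-(δ * d₁ x y)))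
    (hGQ₁ : ∀ z, |(S.Gk1 * S.Qk1s) x z| ≤ c₁' * Real.exp (-(δ * d₁' x z)))
    (hCd : ∀ y y', |S.Ck y y'| ≤ c₀ * Real.exp (-(δ * d₂ y y')))
    (hδC : ∀ y ∈ Λ₀, ∀ y' ∈ Λ₀, |CΛ y y' - S.Ck y y'| ≤ c₀ * Real.exp (-(δ * (d₂ y y' + u y + u y'))))
    (hQ0 : ∀ y z, S.Qs y z ≠ 0 → (y ∈ Λ₀ ↔ z ∈ Λ₀')) (hqs₁ : ∀ y, ∑ z, |S.Qs y z| ≤ qs₁)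
    (hB : ∀ z ∈ Λ₀', |B z| ≤ G) (hS₁ : ∑ y, Real.exp (-(δ / 4 * d₁ x y)) ≤ S₁)
    (hS₂ : ∀ y, ∑ y', Real.exp (-(δ / 4 * d₂ y y')) ≤ S₂) (hS₃ : ∑ z, Real.exp (-(δ / 4 * d₁' x z)) ≤ S₃) :
    |bTilde S ζ ζ' θ' Λ₀ Λ₀' CΛ B x|
      ≤ (|S.α * S.β| * (c₀ * c₁ * qs₁ * S₁ * S₂) * (Real.exp (-(δ * R₂)) + Real.exp (-(δ / 2 * R₃)))
          + |S.γ| * (c₁' * S₃) * Real.exp (-(δ / 2 * R₄))) * G := by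
  have hS₁0 : 0 ≤ S₁ := le_trans (Finset.sum_nonneg fun y _ => (Real.exp_pos _).le) hS₁
  have hS₃0 : 0 ≤ S₃ := le_trans (Finset.sum_nonneg fun z _ => (Real.exp_pos _).le) hS₃
  by_cases hθ : θ' x = 0
  · have hb : bTilde S ζ ζ' θ' Λ₀ Λ₀' CΛ B x = 0 := by simp [bTilde, hθ]
    rw [hb, abs_zero]
    positivity
  have h2 := term2_bound (C := S.Ck) hc₀ hc₁ hδ hG hqs hS₂0 hd₁ hd₂ hu0 hζ01 (hdeep hθ) hGQ hδC hQ0 hqs₁ hB hS₁ hS₂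
  have h3 := term3_bound hc₀ hc₁ hδ hG hqs hS₂0 hd₁ hd₂ hζ01 hfarζ hGQ hCd hqs₁ hB hS₁ hS₂
  have h4 := term4_bound hc₁' hδ hG hd₁' hζ'01 hfarζ' hGQ₁ hB hS₃
  have hθle : |θ' x| ≤ 1 := by rw [abs_le]; constructor <;> linarith [hθ01.1, hθ01.2]
  set T2 := ((ζ ⊙ (S.Gk * S.Qks)) *ᵥ (deltaC Λ₀ CΛ S.Ck *ᵥ (S.Qs *ᵥ B))) x
  set T3 := ((oneSub ζ ⊙ (S.Gk * S.Qks)) *ᵥ (S.Ck *ᵥ (S.Qs *ᵥ restrict Λ₀' B))) x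
  set T4 := ((oneSub ζ' ⊙ (S.Gk1 * S.Qk1s)) *ᵥ restrict Λ₀' B) x
  have hform : bTilde S ζ ζ' θ' Λ₀ Λ₀' CΛ B x = θ' x * (S.α * S.β * T2 - S.α * S.β * T3 + S.γ * T4) := by
    simp only [bTilde]
    ring
  rw [hform, abs_mul]
  have hbr : |S.α * S.β * T2 - S.α * S.β * T3 + S.γ * T4|
      ≤ |S.α * S.β| * |T2| + |S.α * S.β| * |T3| + |S.γ| * |T4| := by
    calc |S.α * S.β * T2 - S.α * S.β * T3 + S.γ * T4|
        ≤ |S.α * S.β * T2 - S.α * S.β * T3| + |S.γ * T4| := abs_add_le _ _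
      _ ≤ (|S.α * S.β * T2| + |S.α * S.β * T3|) + |S.γ * T4| := by gcongr; exact abs_sub _ _
      _ = |S.α * S.β| * |T2| + |S.α * S.β| * |T3| + |S.γ| * |T4| := by
          have e1 : |S.α * S.β * T2| = |S.α * S.β| * |T2| := abs_mul _ _
          have e2 : |S.α * S.β * T3| = |S.α * S.β| * |T3| := abs_mul _ _
          have e3 : |S.γ * T4| = |S.γ| * |T4| := abs_mul _ _
          rw [e1, e2, e3]
  have hmain : |S.α * S.β| * |T2| + |S.α * S.β| * |T3| + |S.γ| * |T4|
      ≤ (|S.α * S.β| * (c₀ * c₁ * qs₁ * S₁ * S₂) * (Real.exp (-(δ * R₂)) + Real.exp (-(δ / 2 * R₃)))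
          + |S.γ| * (c₁' * S₃) * Real.exp (-(δ / 2 * R₄))) * G := by
    have e2 : |S.α * S.β| * |T2| ≤ |S.α * S.β| * (c₁ * S₁ * (c₀ * Real.exp (-(δ * R₂)) * (qs₁ * G) * S₂)) :=
      mul_le_mul_of_nonneg_left h2 (abs_nonneg _)
    have e3 : |S.α * S.β| * |T3| ≤ |S.α * S.β| * (c₁ * Real.exp (-(δ / 2 * R₃)) * (c₀ * S₂ * (qs₁ * G)) * S₁) :=
      mul_le_mul_of_nonneg_left h3 (abs_nonneg _)
    have e4 : |S.γ| * |T4| ≤ |S.γ| * (c₁' * Real.exp (-(δ / 2 * R₄)) * G * S₃) :=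
      mul_le_mul_of_nonneg_left h4 (abs_nonneg _)
    calc |S.α * S.β| * |T2| + |S.α * S.β| * |T3| + |S.γ| * |T4|
        ≤ |S.α * S.β| * (c₁ * S₁ * (c₀ * Real.exp (-(δ * R₂)) * (qs₁ * G) * S₂))
          + |S.α * S.β| * (c₁ * Real.exp (-(δ / 2 * R₃)) * (c₀ * S₂ * (qs₁ * G)) * S₁)
          + |S.γ| * (c₁' * Real.exp (-(δ / 2 * R₄)) * G * S₃) := by linarith
      _ = (|S.α * S.β| * (c₀ * c₁ * qs₁ * S₁ * S₂) * (Real.exp (-(δ * R₂)) + Real.exp (-(δ / 2 * R₃)))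
          + |S.γ| * (c₁' * S₃) * Real.exp (-(δ / 2 * R₄))) * G := by ring
  have hpos : 0 ≤ |S.α * S.β * T2 - S.α * S.β * T3 + S.γ * T4| := abs_nonneg _
  calc |θ' x| * |S.α * S.β * T2 - S.α * S.β * T3 + S.γ * T4|
      ≤ 1 * |S.α * S.β * T2 - S.α * S.β * T3 + S.γ * T4| := mul_le_mul_of_nonneg_right hθle hpos
    _ = |S.α * S.β * T2 - S.α * S.β * T3 + S.γ * T4| := one_mul _
    _ ≤ _ := hbr.trans hmain

/-- **(2.90)** p. 575, *"B̃^{(k)}(x) = O((Lᵏε)^κ) for every κ"*: with the three separations all `≥ ½r(L·ℓ)` (`ℓ = Lᵏε`; in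
Sect. A's convention they are even `≥ ½r(ℓ) ≥ ½r(Lℓ)`), `δ₀ > 0`, the (2.17) threshold `G = 2p(ℓ)/(μ₀ℓ)` and the printed
ranges of the parameters, `|B̃^{(k)}(x)| ≤ (2|a_kaL⁻²|c₀c₁qs₁S₁S₂ + |a_{k+1}L⁻²|c₁′S₃)·C_κ·ℓ^κ` with ONE `C_κ ≥ 0` for all
`0 < ℓ`, `Lℓ ≤ 1` (`decay_nextscale_thr217_pow` at the rate `¼δ₀`). [cite: Balaban1982Higgs2, (2.90) p.575] -/
theorem bTilde_pow {Rr r b₀ p μ₀ L δ : ℝ} (hR : 0 < Rr) (hr : 1 < r) (hb : 0 ≤ b₀) (hp : 0 ≤ p) (hμ : 0 < μ₀)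
    (hL : 1 ≤ L) (hδ : 0 < δ) (κ₀ : ℝ) :
    ∃ Cκ : ℝ, 0 ≤ Cκ ∧ ∀ {ζ : Matrix ι κ ℝ} {ζ' : Matrix ι ν ℝ} {θ' : ι → ℝ} {Λ₀ : Finset κ} {Λ₀' : Finset ν}
      {CΛ : Matrix κ κ ℝ} {B : ν → ℝ} {x : ι} {d₁ : ι → κ → ℝ} {d₁' : ι → ν → ℝ} {d₂ : κ → κ → ℝ} {u : κ → ℝ}
      {c₀ c₁ c₁' R₂ R₃ R₄ qs₁ S₁ S₂ S₃ ℓ : ℝ}, 0 ≤ c₀ → 0 ≤ c₁ → 0 ≤ c₁' → 0 ≤ qs₁ → 0 ≤ S₂ →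
      0 < ℓ → L * ℓ ≤ 1 →
      B2.rFn Rr r (L * ℓ) / 2 ≤ R₂ → B2.rFn Rr r (L * ℓ) / 2 ≤ R₃ → B2.rFn Rr r (L * ℓ) / 2 ≤ R₄ →
      (∀ y, 0 ≤ d₁ x y) → (∀ z, 0 ≤ d₁' x z) → (∀ y y', 0 ≤ d₂ y y') → (∀ y, 0 ≤ u y) →
      (0 ≤ θ' x ∧ θ' x ≤ 1) → (∀ y, 0 ≤ ζ x y ∧ ζ x y ≤ 1) → (∀ z, 0 ≤ ζ' x z ∧ ζ' x z ≤ 1) →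
      (θ' x ≠ 0 → ∀ y, ζ x y ≠ 0 → y ∈ Λ₀ ∧ R₂ ≤ u y) →
      (∀ y, ζ x y ≠ 1 → R₃ ≤ d₁ x y) → (∀ z, ζ' x z ≠ 1 → R₄ ≤ d₁' x z) →
      (∀ y, |(S.Gk * S.Qks) x y| ≤ c₁ * Real.exp (-(δ * d₁ x y))) →
      (∀ z, |(S.Gk1 * S.Qk1s) x z| ≤ c₁' * Real.exp (-(δ * d₁' x z))) →
      (∀ y y', |S.Ck y y'| ≤ c₀ * Real.exp (-(δ * d₂ y y'))) →
      (∀ y ∈ Λ₀, ∀ y' ∈ Λ₀, |CΛ y y' - S.Ck y y'| ≤ c₀ * Real.exp (-(δ * (d₂ y y' + u y + u y')))) →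
      (∀ y z, S.Qs y z ≠ 0 → (y ∈ Λ₀ ↔ z ∈ Λ₀')) → (∀ y, ∑ z, |S.Qs y z| ≤ qs₁) →
      (∀ z ∈ Λ₀', |B z| ≤ 2 * B2LargeField.thrA μ₀ ℓ (B2.pFn b₀ p ℓ)) →
      ∑ y, Real.exp (-(δ / 4 * d₁ x y)) ≤ S₁ → (∀ y, ∑ y', Real.exp (-(δ / 4 * d₂ y y')) ≤ S₂) →
      ∑ z, Real.exp (-(δ / 4 * d₁' x z)) ≤ S₃ →
      |bTilde S ζ ζ' θ' Λ₀ Λ₀' CΛ B x|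
        ≤ (2 * |S.α * S.β| * (c₀ * c₁ * qs₁ * S₁ * S₂) + |S.γ| * (c₁' * S₃)) * (Cκ * ℓ ^ κ₀) := by
  obtain ⟨C, hC0, hC⟩ := decay_nextscale_thr217_pow (a := δ / 4) (by positivity) hR hr hb hp hμ hL κ₀
  refine ⟨C, hC0, ?_⟩
  intro ζ ζ' θ' Λ₀ Λ₀' CΛ B x d₁ d₁' d₂ u c₀ c₁ c₁' R₂ R₃ R₄ qs₁ S₁ S₂ S₃ ℓ hc₀ hc₁ hc₁' hqs hS₂0 hℓ hLℓ hR₂ hR₃ hR₄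
    hd₁ hd₁' hd₂ hu0 hθ01 hζ01 hζ'01 hdeep hfarζ hfarζ' hGQ hGQ₁ hCd hδC hQ0 hqs₁ hB hS₁ hS₂ hS₃
  set G : ℝ := 2 * B2LargeField.thrA μ₀ ℓ (B2.pFn b₀ p ℓ) with hGdef
  have hℓ1 : ℓ ≤ 1 := by nlinarith
  have hG0 : 0 ≤ G := by
    rw [hGdef, two_thrA_pFn_eq hℓ]
    have := pFn_nonneg (p := p) hb hℓ hℓ1
    positivity
  have hmain := bTilde_bound S hc₀ hc₁ hc₁' hδ.le hG0 hqs hS₂0 hd₁ hd₁' hd₂ hu0 hθ01 hζ01 hζ'01 hdeep hfarζ hfarζ'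
    hGQ hGQ₁ hCd hδC hQ0 hqs₁ hB hS₁ hS₂ hS₃
  have hS₁0 : 0 ≤ S₁ := le_trans (Finset.sum_nonneg fun y _ => (Real.exp_pos _).le) hS₁
  have hS₃0 : 0 ≤ S₃ := le_trans (Finset.sum_nonneg fun z _ => (Real.exp_pos _).le) hS₃
  have hLℓ0 : 0 < L * ℓ := mul_pos (lt_of_lt_of_le one_pos hL) hℓ
  have hr0 : 0 ≤ B2.rFn Rr r (L * ℓ) := B2Eq237FormSplit.rFn_nonneg hR.le hLℓ0 hLℓ
  set rr : ℝ := B2.rFn Rr r (L * ℓ) with hrr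
  set E : ℝ := Real.exp (-(δ / 4 * rr)) with hE
  have hE2 : Real.exp (-(δ * R₂)) ≤ E := by
    rw [hE, Real.exp_le_exp]
    have : δ / 4 * rr ≤ δ * R₂ := by nlinarith [hδ.le, hr0, hR₂]
    linarith
  have hE3 : Real.exp (-(δ / 2 * R₃)) ≤ E := by
    rw [hE, Real.exp_le_exp]
    have : δ / 4 * rr ≤ δ / 2 * R₃ := by nlinarith [hδ.le, hr0, hR₃]
    linarith
  have hE4 : Real.exp (-(δ / 2 * R₄)) ≤ E := by
    rw [hE, Real.exp_le_exp]
    have : δ / 4 * rr ≤ δ / 2 * R₄ := by nlinarith [hδ.le, hr0, hR₄]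
    linarith
  have hEG : E * G ≤ C * ℓ ^ κ₀ := hC ℓ hℓ hLℓ
  calc |bTilde S ζ ζ' θ' Λ₀ Λ₀' CΛ B x|
      ≤ (|S.α * S.β| * (c₀ * c₁ * qs₁ * S₁ * S₂) * (Real.exp (-(δ * R₂)) + Real.exp (-(δ / 2 * R₃)))
          + |S.γ| * (c₁' * S₃) * Real.exp (-(δ / 2 * R₄))) * G := hmain
    _ ≤ (|S.α * S.β| * (c₀ * c₁ * qs₁ * S₁ * S₂) * (E + E) + |S.γ| * (c₁' * S₃) * E) * G := by
        gcongr
    _ = (2 * |S.α * S.β| * (c₀ * c₁ * qs₁ * S₁ * S₂) + |S.γ| * (c₁' * S₃)) * (E * G) := by ring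
    _ ≤ (2 * |S.α * S.β| * (c₀ * c₁ * qs₁ * S₁ * S₂) + |S.γ| * (c₁' * S₃)) * (C * ℓ ^ κ₀) :=
        mul_le_mul_of_nonneg_left hEG (by positivity)

omit [Fintype ν] [DecidableEq κ] [DecidableEq ν] in
/-- **(2.91)** p. 575: *"From (2.86) it follows that the field θ_{k+1}A′^{(k)} is smooth and small: |θ_{k+1}A′^{(k)}(x)| ≦
O(1)p(Lᵏε)"* — `θ_{k+1}ζ^{(k)}(x, ·)` sees only `Λ₁^{(k)}` (`hθζ₁`), where (2.86) bounds `|A′(y)| ≤ c₂p(Lᵏε)`; with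
`|𝒢(x,y)| ≤ c₁e^{−δ₀d₁(x,y)}`, `0 ≤ ζ ≤ 1`, `|θ_{k+1}| ≤ 1`: `|θ_{k+1}(x)A′^{(k)}(x)| ≤ |a_k|·c₁S₁·c₂p(Lᵏε)`.
[cite: Balaban1982Higgs2, (2.91) p.575] -/
theorem eq291_bound {ζ : Matrix ι κ ℝ} {θ' : ι → ℝ} {Λ₁ : Finset κ} {A' : κ → ℝ} {x : ι} {d₁ : ι → κ → ℝ}
    {c₁ c₂ δ pℓ S₁ : ℝ} (hc₁ : 0 ≤ c₁) (hδ : 0 ≤ δ) (hc₂p : 0 ≤ c₂ * pℓ) (hd₁ : ∀ y, 0 ≤ d₁ x y)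
    (hθ01 : 0 ≤ θ' x ∧ θ' x ≤ 1) (hζ01 : ∀ y, 0 ≤ ζ x y ∧ ζ x y ≤ 1)
    (hθζ₁ : θ' x ≠ 0 → ∀ y, ζ x y ≠ 0 → y ∈ Λ₁)
    (hGQ : ∀ y, |(S.Gk * S.Qks) x y| ≤ c₁ * Real.exp (-(δ * d₁ x y)))
    (h286 : ∀ y ∈ Λ₁, |A' y| ≤ c₂ * pℓ) (hS₁ : ∑ y, Real.exp (-(δ / 4 * d₁ x y)) ≤ S₁) :
    |θ' x * Ak S ζ A' x| ≤ |S.α| * (c₁ * S₁) * (c₂ * pℓ) := by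
  have hS₁0 : 0 ≤ S₁ := le_trans (Finset.sum_nonneg fun y _ => (Real.exp_pos _).le) hS₁
  by_cases hθ : θ' x = 0
  · rw [hθ, zero_mul, abs_zero]; positivity
  rw [Ak_apply, abs_mul, abs_mul]
  have hθle : |θ' x| ≤ 1 := by rw [abs_le]; constructor <;> linarith [hθ01.1, hθ01.2]
  have hK : ∀ y ∈ (Finset.univ : Finset κ), |ζ x y * (S.Gk * S.Qks) x y| ≤ c₁ * Real.exp (-(δ * d₁ x y)) := by
    intro y _
    rw [abs_mul]
    calc |ζ x y| * |(S.Gk * S.Qks) x y| ≤ 1 * (c₁ * Real.exp (-(δ * d₁ x y))) := by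
          refine mul_le_mul ?_ (hGQ y) (abs_nonneg _) zero_le_one
          rw [abs_le]; constructor <;> linarith [(hζ01 y).1, (hζ01 y).2]
      _ = c₁ * Real.exp (-(δ * d₁ x y)) := one_mul _
  have hsum : |∑ y, ζ x y * (S.Gk * S.Qks) x y * A' y| ≤ (c₁ * S₁) * (c₂ * pℓ) := by
    calc |∑ y, ζ x y * (S.Gk * S.Qks) x y * A' y|
        ≤ ∑ y, |ζ x y * (S.Gk * S.Qks) x y * A' y| := Finset.abs_sum_le_sum_abs _ _
      _ ≤ ∑ y, |ζ x y * (S.Gk * S.Qks) x y| * (c₂ * pℓ) := by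
          refine Finset.sum_le_sum fun y _ => ?_
          rw [abs_mul]
          by_cases hy : ζ x y = 0
          · rw [hy, zero_mul, abs_zero, zero_mul, zero_mul]
          · exact mul_le_mul_of_nonneg_left (h286 y (hθζ₁ hθ y hy)) (abs_nonneg _)
      _ = (∑ y, |ζ x y * (S.Gk * S.Qks) x y|) * (c₂ * pℓ) := by rw [Finset.sum_mul]
      _ ≤ (c₁ * S₁) * (c₂ * pℓ) :=
          mul_le_mul_of_nonneg_right (sum_abs_kernel_le hc₁ hδ hK (fun y _ => hd₁ y) hS₁) hc₂p
  calc |θ' x| * (|S.α| * |∑ y, ζ x y * (S.Gk * S.Qks) x y * A' y|)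
      ≤ 1 * (|S.α| * ((c₁ * S₁) * (c₂ * pℓ))) := by
        refine mul_le_mul hθle (mul_le_mul_of_nonneg_left hsum (abs_nonneg _)) (by positivity) zero_le_one
    _ = |S.α| * (c₁ * S₁) * (c₂ * pℓ) := by ring

end Smallness

end Literature.MathematicalPhysics.QuantumFieldTheory.Balaban1983to89.B2Eq289Decomposition
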